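import Literature.Analysis.FluidPDE.SteadyNavierStokes
import Literature.Analysis.FluidPDE.StatisticalSolutionEnergyEq
import Literature.Analysis.FluidPDE.ClassicalNSFourierModes
import Literature.Analysis.Convolution.YoungInequality
import Literature.Analysis.FunctionSpaces.TorusVectorParseval
import Literature.Analysis.FunctionSpaces.TorusFourierSynthesis
import Literature.Analysis.FunctionSpaces.TorusFourierSeries
import Literature.Analysis.FunctionSpaces.TorusSobolevNormProofs
import Mathlib.MeasureTheory.Integral.Lebesgue.Countable
import HarnessLib

/-!
# Regularity of steady weak solutions of the Navier–Stokes equations on `T^d`, `d ≤ 3` (proofs)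

This file **discharges** the named fact
`Literature.Analysis.FluidPDE.Torus.Temam1979_steadyWeakSolution_smooth`
(`SteadyNavierStokes.lean`; Temam 1979, Ch. II §1, Prop. 1.1, space-periodic case; the existence
theorem Thm. 1.2 is discharged in the sibling file `SteadyNavierStokesProofs.lean`): for
`#d ≤ 3`, `ν > 0`, a smooth force `f` and a steady weak solution `u ∈ V` of
`(f, w) + ν (u, Δw) + ∫ (u ⊗ u) : ∇w = 0` (`w ∈ 𝒱`), the velocity `u` is a.e. equal to a `C^∞`
field (`Torus.Temam1979_steadyWeakSolution_smooth_holds`).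

## The proof (Fourier side)

Temam's printed proof (Prop. 1.1; likewise Constantin–Foias 1988, Ch. 7, via `D(A^{3/4})` and
the fractional estimates (6.9) of the trilinear form) is an elliptic bootstrap: `u ∈ H¹ ⊂ L⁶`,
`(u·∇)u ∈ L^{3/2}`, `L^p`-regularity of the Stokes problem, and iteration. Neither `L^p` Stokes
regularity nor fractional product laws on `T^d` are in the tree; here the same bootstrap is run
**on the Fourier lattice `ℤ^d`**, where the Stokes operator is diagonal and products become
convolutions, using only `ℓ^p(ℤ^d)` inequalities:

1. *Coefficient inequality.* Writing `û(k) = 𝓕(complexify ∘ u)(k)`, `A(k) = ‖û(k)‖`,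
   `⟨k⟩ = (1 + |k|²)^{1/2}` (`Torus.sobolevWeight`) and `(A ⋆ A)(k) = ∑_l A(k - l) A(l)`, testing
   the weak formulation against the single real modes `Re (e_k z)`, `k · z = 0`
   (`Torus.realTrigPoly {k}`; they lie in `𝒱`), gives
   `4π²ν|k|² Re⟪û(k), z⟫ = Re⟪f̂(k), z⟫ + ∫ ⟪D(Re e_k z) u, u⟫` (`tested_singleMode`); the inertial
   term is `∑ⱼ Re⟪𝓕(uⱼu)(k), 2πi kⱼ z⟫` and `|𝓕(uⱼuᵢ)(k)| ≤ (A ⋆ A)(k)` by the polarised Parseval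
   identity (`enorm_mFourierCoeff_mul_apply_le`). Since `û(k) ⊥ k` for `u ∈ H`, the choice
   `z = û(k)/‖û(k)‖` yields `⟨k⟩² A(k) ≤ C (‖f̂(k)‖ + ⟨k⟩ (A ⋆ A)(k))`
   (`weight_two_mul_enorm_coeff_le`).
2. *Lattice bootstrap* (`tsum_weight_mul_ne_top`, `#d ≤ 3`): from `∑ ⟨k⟩² A² < ∞` (`u ∈ V`) and
   the inequality of step 1, with Young's convolution inequality on `ℤ^d` (the tree's
   `Convolution.lintegral_rpow_lintegral_sub_mul_le_young` for the counting measure), Hölder's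
   inequality, the splitting `⟨k⟩^s ≤ 2^s (⟨k - l⟩^s + ⟨l⟩^s)` and the lattice sums
   `∑ ⟨k⟩^{-q} < ∞` (`q > #d`): `A ∈ ℓ^{5/4}` ⇒ `⟨·⟩²A ∈ ℓ^{10/3}` ⇒ `⟨·⟩A ∈ ℓ^{5/3}`,
   `A ∈ ℓ^{10/9}` ⇒ `⟨·⟩²A ∈ ℓ²` ⇒ `A ∈ ℓ¹`, `⟨·⟩A ∈ ℓ^{5/4}` ⇒ `⟨·⟩²A ∈ ℓ^{5/4}` ⇒ `⟨·⟩A ∈ ℓ¹`,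
   and then by induction `⟨·⟩^m A ∈ ℓ¹` for every `m` — the coefficients decay rapidly.
3. *Synthesis.* The Fourier series of the coefficients is a smooth field (`Torus.fourierSynth`,
   `RapidDecay.isSmooth_fourierSynth`) with the same coefficients as `complexify ∘ u`, hence a.e.
   equal to it (`Torus.ae_eq_of_forall_mFourierCoeff_eq`); its real part is the smooth
   representative.

Everything is proved; no definitions and no new named facts are introduced (the auxiliary
sequence inequalities are stated for `ℝ≥0∞`-valued families so that no summability hypotheses
are needed).

## Mathlib / tree search

Mathlib: `ENNReal.inner_le_Lp_mul_Lq` (Hölder for finite sums; the `tsum` form is derived here),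
`MeasureTheory.lintegral_count`, `Real.summable_abs_int_rpow`, `enorm_tsum_le_tsum_enorm`,
`ENNReal.rpow_add_le_mul_rpow_add_rpow`; no discrete Young inequality (searched `young`,
`lconvolution`). Tree: `Convolution.lintegral_rpow_lintegral_sub_mul_le_young` (Young),
`Torus.summable_pi_prod_of_summable`, `Torus.prod_one_add_sq_le_pow` (lattice sums),
`Torus.hasSum_conj_mul_mFourierCoeff` (polarised Parseval), `Torus.realTrigPoly` API
(`integral_inner_realTrigPoly_singleton`, `laplacian_realTrigPoly_singleton`,
`isDivFree_realTrigPoly_singleton`, `partialDeriv_realTrigPoly`,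
`integral_mFourier`), `Torus.isWeaklyDivFree_of_mem_energySpace`,
`IsWeaklyDivFree.sum_mul_mFourierCoeff_eq_zero`, `Torus.mFourierCoeff_complexify_coe_zero_of_mem`,
`exists_transversal_unit_re_inner_eq`, `Torus.RapidDecay`/`fourierSynth` API,
`Torus.ae_eq_of_forall_mFourierCoeff_eq`.

## References

* R. Temam, *Navier–Stokes Equations: Theory and Numerical Analysis*, North-Holland (1979),
  Ch. II §1, Prop. 1.1 (regularity of stationary weak solutions, `n ≤ 3`), Thm. 1.2.
  [Temam1979]
* P. Constantin, C. Foias, *Navier–Stokes Equations*, Univ. Chicago Press (1988), Ch. 7,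
  (7.1)–(7.2), Thm. 7.3 and (7.10)–(7.11) (the `D(A^{3/4})` bootstrap for steady solutions).
* J. C. Robinson, J. L. Rodrigo, W. Sadowski, *The Three-Dimensional Navier–Stokes Equations*,
  CUP (2016), Thm. A.10 (Young's inequality), Ex. 2.14 (transversality of `û(k)`).
* L. Grafakos, *Classical Fourier Analysis*, 3rd ed. (2014), Prop. 3.2.7 (3) (Parseval),
  Thm. 3.3.9 / Prop. 3.2.5 (smooth functions and rapidly decaying coefficients).
-/

noncomputable section

open MeasureTheory Filter UnitAddTorus
open scoped ENNReal NNReal Topology InnerProductSpace ComplexConjugate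

namespace Literature.Analysis.FluidPDE

namespace SteadyNS

open Literature.Analysis.FunctionSpaces Literature.Analysis.FunctionSpaces.Torus

variable {d : Type*} [Fintype d]

/-! ## Sequence inequalities in `ℝ≥0∞` -/



omit [Fintype d] in
/-- **Hölder's inequality for `ℝ≥0∞`-valued families** (infinite sums, conjugate real exponents):
`∑ f g ≤ (∑ f^p)^{1/p} (∑ g^q)^{1/q}` — the supremum over finite sets of Mathlib's
`ENNReal.inner_le_Lp_mul_Lq`. [folklore] -/
theorem tsum_mul_le_Lp_mul_Lq {ι : Type*} (f g : ι → ℝ≥0∞) {p q : ℝ} (hpq : p.HolderConjugate q) :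
    ∑' i, f i * g i ≤ (∑' i, f i ^ p) ^ (1 / p) * (∑' i, g i ^ q) ^ (1 / q) := by
  rw [ENNReal.tsum_eq_iSup_sum]
  refine iSup_le fun s => (ENNReal.inner_le_Lp_mul_Lq s f g hpq).trans ?_
  gcongr
  · exact (one_div_nonneg.2 hpq.nonneg)
  · exact ENNReal.sum_le_tsum _
  · exact (one_div_nonneg.2 hpq.symm.nonneg)
  · exact ENNReal.sum_le_tsum _

omit [Fintype d] in
/-- Hölder's inequality in the form `∑ (B w)^a ≤ (∑ B^r)^{a/r} (∑ w^{ar/(r-a)})^{(r-a)/r}` for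
`0 < a < r` (exponents `r/a` and `r/(r-a)`). [folklore] -/
theorem tsum_mul_rpow_le {ι : Type*} (B w : ι → ℝ≥0∞) {a r : ℝ} (ha : 0 < a) (har : a < r) :
    ∑' i, (B i * w i) ^ a ≤
      (∑' i, B i ^ r) ^ (a / r) * (∑' i, w i ^ (a * r / (r - a))) ^ ((r - a) / r) := by
  have hr : 0 < r := ha.trans har
  have hp : 1 < r / a := (one_lt_div ha).2 har
  have hpq : (r / a).HolderConjugate (r / (r - a)) := by
    refine Real.holderConjugate_iff.2 ⟨hp, ?_⟩
    field_simp
    ring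
  have h := tsum_mul_le_Lp_mul_Lq (fun i => B i ^ a) (fun i => w i ^ a) hpq
  have h1 : ∀ i, (B i ^ a) ^ (r / a) = B i ^ r := fun i => by
    rw [← ENNReal.rpow_mul, mul_div_cancel₀ _ ha.ne']
  have h2 : ∀ i, (w i ^ a) ^ (r / (r - a)) = w i ^ (a * r / (r - a)) := fun i => by
    rw [← ENNReal.rpow_mul, mul_div_assoc]
  simp only [h1, h2] at h
  have h3 : ∀ i, (B i * w i) ^ a = B i ^ a * w i ^ a := fun i =>
    ENNReal.mul_rpow_of_nonneg _ _ ha.le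
  simp only [h3]
  convert h using 2
  · rw [one_div_div]
  · rw [one_div_div]

omit [Fintype d] in
/-- Finiteness form of `tsum_mul_rpow_le`. [folklore] -/
theorem tsum_mul_rpow_ne_top {ι : Type*} {B w : ι → ℝ≥0∞} {a r : ℝ} (ha : 0 < a) (har : a < r)
    (hB : ∑' i, B i ^ r ≠ ⊤) (hw : ∑' i, w i ^ (a * r / (r - a)) ≠ ⊤) :
    ∑' i, (B i * w i) ^ a ≠ ⊤ := by
  refine ne_top_of_le_ne_top ?_ (tsum_mul_rpow_le B w ha har)
  have hr : 0 < r := ha.trans har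
  exact ENNReal.mul_ne_top (ENNReal.rpow_ne_top_of_nonneg (div_nonneg ha.le hr.le) hB)
    (ENNReal.rpow_ne_top_of_nonneg (div_nonneg (sub_nonneg.2 har.le) hr.le) hw)


/-- **Young's convolution inequality on the lattice `ℤ^d`** for `ℝ≥0∞`-valued families:
`∑_k (∑_l f(k-l) g(l))^r ≤ (∑ f^b)^{r/b} (∑ g^m)^{r/m}` for `1 ≤ b, m`, `0 < r`,
`1/b + 1/m = 1 + 1/r` — the tree's `Convolution.lintegral_rpow_lintegral_sub_mul_le_young`
for the counting measure on `ℤ^d` (Robinson–Rodrigo–Sadowski 2016, Thm. A.10).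
[cite: RobinsonRodrigoSadowskiCUP2016, Thm. A.10] -/
theorem young_lattice (f g : (d → ℤ) → ℝ≥0∞) {b m r : ℝ} (hb : 1 ≤ b) (hm : 1 ≤ m) (hr : 0 < r)
    (hbmr : 1 / b + 1 / m = 1 + 1 / r) :
    ∑' k, (∑' l, f (k - l) * g l) ^ r ≤ (∑' l, f l ^ b) ^ (r / b) * (∑' l, g l ^ m) ^ (r / m) := by
  have h := Literature.Analysis.Convolution.lintegral_rpow_lintegral_sub_mul_le_young
    (μ := (Measure.count : Measure (d → ℤ))) (K := f) (Φ := g)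
    (measurable_of_countable f).aemeasurable (measurable_of_countable g).aemeasurable hb hm hr hbmr
  simpa only [lintegral_count] using h

omit [Fintype d] in
/-- Commutativity of the lattice convolution of `ℝ≥0∞`-valued families:
`∑_l f(k-l) g(l) = ∑_l g(k-l) f(l)` (substitution `l ↦ k - l`). [folklore] -/
theorem lconv_comm (f g : (d → ℤ) → ℝ≥0∞) (k : d → ℤ) :
    ∑' l, f (k - l) * g l = ∑' l, g (k - l) * f l := by
  rw [← (Equiv.subLeft k).tsum_eq]
  refine tsum_congr fun l => ?_
  simp [Equiv.subLeft_apply, mul_comm]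




/-! ## The weights `⟨k⟩^s = (1 + |k|²)^{s/2}` and lattice sums -/

/-- `⟨k⟩² = 1 + |k|²`. [folklore] -/
theorem sobolevWeight_two (k : d → ℤ) : sobolevWeight 2 k = 1 + freqNormSq k := by
  rw [sobolevWeight, div_self two_ne_zero, Real.rpow_one]

/-- `0 < 1 + |k|²`. [folklore] -/
theorem one_add_freqNormSq_pos (k : d → ℤ) : 0 < 1 + freqNormSq k := by
  linarith [freqNormSq_nonneg k]

/-- `⟨k⟩^{s+t} = ⟨k⟩^s ⟨k⟩^t`. [folklore] -/
theorem sobolevWeight_add (s t : ℝ) (k : d → ℤ) :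
    sobolevWeight (s + t) k = sobolevWeight s k * sobolevWeight t k := by
  rw [sobolevWeight, sobolevWeight, sobolevWeight, add_div,
    Real.rpow_add (one_add_freqNormSq_pos k)]

/-- `⟨k⟩^{s p} = (⟨k⟩^s)^p`. [folklore] -/
theorem sobolevWeight_mul (s p : ℝ) (k : d → ℤ) :
    sobolevWeight (s * p) k = sobolevWeight s k ^ p := by
  rw [sobolevWeight, sobolevWeight, mul_div_right_comm,
    Real.rpow_mul (one_add_freqNormSq_pos k).le]

/-- `⟨k⟩² = 1 + |k|²` with a natural-number square. [folklore] -/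
theorem sobolevWeight_one_sq (k : d → ℤ) : sobolevWeight 1 k ^ 2 = 1 + freqNormSq k := by
  rw [← sobolevWeight_two, show (2 : ℝ) = 1 * 2 by norm_num, sobolevWeight_mul, Real.rpow_two]

/-- Parallelogram-type bound `|k|² ≤ 2|k - l|² + 2|l|²`. [folklore] -/
theorem freqNormSq_le_two_mul_add (k l : d → ℤ) :
    freqNormSq k ≤ 2 * freqNormSq (k - l) + 2 * freqNormSq l := by
  simp only [freqNormSq, Finset.mul_sum, ← Finset.sum_add_distrib]
  refine Finset.sum_le_sum fun i _ => ?_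
  have : (k i : ℝ) = ((k - l) i : ℝ) + (l i : ℝ) := by push_cast [Pi.sub_apply]; ring
  rw [this]
  nlinarith [sq_nonneg (((k - l) i : ℝ) - (l i : ℝ))]

/-- Peetre-type splitting of the weights: `⟨k⟩^s ≤ 2^s (⟨k - l⟩^s + ⟨l⟩^s)` for `s ≥ 0`.
[folklore] -/
theorem sobolevWeight_le_two_rpow_mul_add {s : ℝ} (hs : 0 ≤ s) (k l : d → ℤ) :
    sobolevWeight s k ≤ 2 ^ s * (sobolevWeight s (k - l) + sobolevWeight s l) := by
  set M : ℝ := max (1 + freqNormSq (k - l)) (1 + freqNormSq l) with hM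
  have hM0 : 0 ≤ M := (one_add_freqNormSq_pos l).le.trans (le_max_right _ _)
  have h1 : 1 + freqNormSq k ≤ 4 * M := by
    have := freqNormSq_le_two_mul_add k l
    have h2 : 1 + freqNormSq (k - l) ≤ M := le_max_left _ _
    have h3 : 1 + freqNormSq l ≤ M := le_max_right _ _
    linarith
  have hs2 : 0 ≤ s / 2 := by positivity
  have h4 : (4 : ℝ) ^ (s / 2) = 2 ^ s := by
    rw [show (4 : ℝ) = 2 ^ (2 : ℝ) by norm_num, ← Real.rpow_mul (by norm_num : (0:ℝ) ≤ 2)]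
    congr 1; ring
  have hmax : M ^ (s / 2) ≤ sobolevWeight s (k - l) + sobolevWeight s l := by
    simp only [sobolevWeight]
    rcases le_total (1 + freqNormSq (k - l)) (1 + freqNormSq l) with h | h
    · rw [hM, max_eq_right h]
      exact le_add_of_nonneg_left (Real.rpow_nonneg (one_add_freqNormSq_pos _).le _)
    · rw [hM, max_eq_left h]
      exact le_add_of_nonneg_right (Real.rpow_nonneg (one_add_freqNormSq_pos _).le _)
  calc sobolevWeight s k = (1 + freqNormSq k) ^ (s / 2) := rfl
    _ ≤ (4 * M) ^ (s / 2) := Real.rpow_le_rpow (one_add_freqNormSq_pos k).le h1 hs2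
    _ = 2 ^ s * M ^ (s / 2) := by rw [Real.mul_rpow (by norm_num) hM0, h4]
    _ ≤ 2 ^ s * (sobolevWeight s (k - l) + sobolevWeight s l) :=
        mul_le_mul_of_nonneg_left hmax (by positivity)

/-- **Lattice `p`-series**: `∑_{k ∈ ℤ^d} ⟨k⟩^{-q} < ∞` for `q > #d` (comparison with the product
`∏ᵢ (1 + kᵢ²)^{-q/(2#d)}`, the tree's `Torus.summable_pi_prod_of_summable`, and the one-dimensional
`p`-series `Real.summable_abs_int_rpow`; Grafakos 2014, §3.3.1). [folklore] -/
theorem summable_sobolevWeight_neg {q : ℝ} (hq : (Fintype.card d : ℝ) < q) :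
    Summable fun k : d → ℤ => sobolevWeight (-q) k := by
  rcases isEmpty_or_nonempty d with hd | hd
  · haveI : Unique (d → ℤ) := Pi.uniqueOfIsEmpty _
    exact .of_finite
  · set n : ℕ := Fintype.card d with hn
    have hn0 : 0 < n := Fintype.card_pos
    have hn0' : (0 : ℝ) < n := by exact_mod_cast hn0
    have hq0 : 0 < q := lt_of_le_of_lt (Nat.cast_nonneg _) hq
    -- one-dimensional comparison sequence
    set t : ℝ := q / n with ht
    have ht1 : 1 < t := by rw [ht, lt_div_iff₀ hn0']; linarith
    set a : ℤ → ℝ := fun j => (1 + (j : ℝ) ^ 2) ^ (-(t / 2)) with ha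
    have ha0 : ∀ j, 0 ≤ a j := fun j => Real.rpow_nonneg (by positivity) _
    have has : Summable a := by
      have hcmp := Real.summable_abs_int_rpow ht1
      -- `a j ≤ |j|^{-t}` for `j ≠ 0`, plus the single term `j = 0`
      have h0 : Summable (fun j : ℤ => if j = 0 then (1 : ℝ) else 0) :=
        summable_of_ne_finset_zero (s := {0}) fun j hj => by
          rw [Finset.mem_singleton] at hj; rw [if_neg hj]
      refine Summable.of_nonneg_of_le ha0 (fun j => ?_) (hcmp.add h0)
      by_cases hj : j = 0
      · subst hj
        simp only [ha, if_true, Int.cast_zero]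
        norm_num
        exact Real.rpow_nonneg le_rfl _
      · rw [if_neg hj, add_zero, ha]
        dsimp only
        have hjpos : 0 < |(j : ℝ)| := abs_pos.2 (by exact_mod_cast hj)
        calc (1 + (j : ℝ) ^ 2) ^ (-(t / 2)) ≤ ((j : ℝ) ^ 2) ^ (-(t / 2)) :=
              Real.rpow_le_rpow_of_nonpos (by positivity) (by linarith) (by linarith)
          _ = |(j : ℝ)| ^ (-t) := by
              rw [← sq_abs, ← Real.rpow_natCast, ← Real.rpow_mul hjpos.le]
              congr 1; push_cast; ring
    have hprod := summable_pi_prod_of_summable (d := d) ha0 has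
    refine Summable.of_nonneg_of_le (fun k => (sobolevWeight_pos _ k).le) (fun k => ?_) hprod
    -- `(1 + |k|²)^{-q/2} ≤ ∏ᵢ (1 + kᵢ²)^{-t/2}` since `∏ᵢ (1 + kᵢ²) ≤ (1 + |k|²)^n`
    have hP : ∏ i, (1 + ((k i : ℝ)) ^ 2) ≤ (1 + freqNormSq k) ^ n := prod_one_add_sq_le_pow k
    have hPpos : 0 < ∏ i, (1 + ((k i : ℝ)) ^ 2) := Finset.prod_pos fun i _ => by positivity
    calc sobolevWeight (-q) k = ((1 + freqNormSq k) ^ (n : ℝ)) ^ (-(t / 2)) := by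
          rw [sobolevWeight, ← Real.rpow_mul (one_add_freqNormSq_pos k).le]
          congr 1
          rw [ht]; field_simp
      _ ≤ (∏ i, (1 + ((k i : ℝ)) ^ 2)) ^ (-(t / 2)) := by
          refine Real.rpow_le_rpow_of_nonpos hPpos ?_ (by linarith)
          rwa [Real.rpow_natCast]
      _ = ∏ i, a (k i) := by
          rw [ha]
          exact (Real.finsetProd_rpow Finset.univ (fun i => 1 + ((k i : ℝ)) ^ 2)
            (fun i _ => by positivity) (-(t / 2))).symm

/-- `∑_k ⟨k⟩^{-q} < ∞` in `ℝ≥0∞` for `q > #d`. [folklore] -/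
theorem tsum_ofReal_sobolevWeight_neg_ne_top {q : ℝ} (hq : (Fintype.card d : ℝ) < q) :
    ∑' k : d → ℤ, ENNReal.ofReal (sobolevWeight (-q) k) ≠ ⊤ := by
  rw [← ENNReal.ofReal_tsum_of_nonneg (fun k => (sobolevWeight_pos _ k).le)
    (summable_sobolevWeight_neg hq)]
  exact ENNReal.ofReal_ne_top

/-- `⟨k⟩^s ⟨k⟩^t = ⟨k⟩^{s+t}` in `ℝ≥0∞`. [folklore] -/
theorem ofReal_sobolevWeight_mul (s t : ℝ) (k : d → ℤ) :
    ENNReal.ofReal (sobolevWeight s k) * ENNReal.ofReal (sobolevWeight t k) =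
      ENNReal.ofReal (sobolevWeight (s + t) k) := by
  rw [← ENNReal.ofReal_mul (sobolevWeight_pos s k).le, sobolevWeight_add]

/-- `(⟨k⟩^s)^p = ⟨k⟩^{s p}` in `ℝ≥0∞`. [folklore] -/
theorem ofReal_sobolevWeight_rpow (s p : ℝ) (k : d → ℤ) :
    ENNReal.ofReal (sobolevWeight s k) ^ p = ENNReal.ofReal (sobolevWeight (s * p) k) := by
  rw [ENNReal.ofReal_rpow_of_pos (sobolevWeight_pos s k), sobolevWeight_mul]

/-- `⟨k⟩⁰ = 1` in `ℝ≥0∞`. [folklore] -/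
theorem ofReal_sobolevWeight_zero (k : d → ℤ) : ENNReal.ofReal (sobolevWeight 0 k) = 1 := by
  rw [sobolevWeight_zero, ENNReal.ofReal_one]

/-- `⟨k⟩^s ≠ 0` in `ℝ≥0∞`. [folklore] -/
theorem ofReal_sobolevWeight_ne_zero (s : ℝ) (k : d → ℤ) : ENNReal.ofReal (sobolevWeight s k) ≠ 0 :=
  (ENNReal.ofReal_pos.2 (sobolevWeight_pos s k)).ne'

/-- Splitting of the weights in `ℝ≥0∞`: `⟨k⟩^s ≤ 2^s (⟨k - l⟩^s + ⟨l⟩^s)`, `s ≥ 0`. [folklore] -/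
theorem ofReal_sobolevWeight_peetre {s : ℝ} (hs : 0 ≤ s) (k l : d → ℤ) :
    ENNReal.ofReal (sobolevWeight s k) ≤
      (2 : ℝ≥0∞) ^ s *
        (ENNReal.ofReal (sobolevWeight s (k - l)) + ENNReal.ofReal (sobolevWeight s l)) := by
  calc ENNReal.ofReal (sobolevWeight s k)
      ≤ ENNReal.ofReal (2 ^ s * (sobolevWeight s (k - l) + sobolevWeight s l)) :=
        ENNReal.ofReal_le_ofReal (sobolevWeight_le_two_rpow_mul_add hs k l)
    _ = (2 : ℝ≥0∞) ^ s *
        (ENNReal.ofReal (sobolevWeight s (k - l)) + ENNReal.ofReal (sobolevWeight s l)) := by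
        rw [ENNReal.ofReal_mul (by positivity), ENNReal.ofReal_add (sobolevWeight_pos _ _).le
          (sobolevWeight_pos _ _).le, ← ENNReal.ofReal_ofNat 2, ENNReal.ofReal_rpow_of_pos two_pos]


/-! ## The lattice bootstrap -/

section Bootstrap

variable {A F : (d → ℤ) → ℝ≥0∞} {C : ℝ≥0∞}

/-- From rapid decay of `F` in the form `∑ ⟨k⟩^s F(k) < ∞` for all `s`: all the weighted
`r`-th power sums of `F`, `r ≥ 1`, are finite (`F ≤ ∑ F`, `F^r ≤ (∑ F)^{r-1} F`). [folklore] -/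
theorem tsum_weight_mul_rpow_ne_top_of_rapid
    (hF : ∀ s : ℝ, ∑' k, ENNReal.ofReal (sobolevWeight s k) * F k ≠ ⊤) {r : ℝ}
    (hr : 1 ≤ r) (s : ℝ) : ∑' k, ENNReal.ofReal (sobolevWeight s k) * F k ^ r ≠ ⊤ := by
  set T : ℝ≥0∞ := ∑' k, F k with hT
  have hT' : T ≠ ⊤ := by
    have h0 := hF 0
    simp only [sobolevWeight_zero, ENNReal.ofReal_one, one_mul] at h0
    exact h0
  have hFle : ∀ k, F k ≤ T := fun k => ENNReal.le_tsum k
  have hpow : ∀ k, F k ^ r ≤ T ^ (r - 1) * F k := by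
    intro k
    by_cases h0 : F k = 0
    · rw [h0, ENNReal.zero_rpow_of_pos (by linarith)]; exact zero_le
    · have hne : F k ≠ ⊤ := ne_top_of_le_ne_top hT' (hFle k)
      conv_lhs => rw [show r = (r - 1) + 1 by ring, ENNReal.rpow_add _ _ h0 hne, ENNReal.rpow_one]
      exact mul_le_mul_left (ENNReal.rpow_le_rpow (hFle k) (by linarith)) _
  refine ne_top_of_le_ne_top ?_ (ENNReal.tsum_le_tsum fun k => mul_le_mul_right (hpow k) _)
  have : ∑' k, ENNReal.ofReal (sobolevWeight s k) * (T ^ (r - 1) * F k) =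
      T ^ (r - 1) * ∑' k, ENNReal.ofReal (sobolevWeight s k) * F k := by
    rw [← ENNReal.tsum_mul_left]
    refine tsum_congr fun k => ?_
    ring
  rw [this]
  exact ENNReal.mul_ne_top (ENNReal.rpow_ne_top_of_nonneg (by linarith) hT') (hF s)

/-- Weighted splitting of the lattice self-convolution:
`⟨k⟩^s (A ⋆ A)(k) ≤ 2^{s+1} ((⟨·⟩^s A) ⋆ A)(k)` (`s ≥ 0`). [folklore] -/
theorem weight_mul_conv_le {s : ℝ} (hs : 0 ≤ s) (A : (d → ℤ) → ℝ≥0∞) (k : d → ℤ) :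
    ENNReal.ofReal (sobolevWeight s k) * ∑' l, A (k - l) * A l ≤
      (2 : ℝ≥0∞) ^ (s + 1) *
        ∑' l, (ENNReal.ofReal (sobolevWeight s (k - l)) * A (k - l)) * A l := by
  rw [← ENNReal.tsum_mul_left]
  calc ∑' l, ENNReal.ofReal (sobolevWeight s k) * (A (k - l) * A l)
      ≤ ∑' l, (2 : ℝ≥0∞) ^ s * ((ENNReal.ofReal (sobolevWeight s (k - l)) * A (k - l)) * A l +
          A (k - l) * (ENNReal.ofReal (sobolevWeight s l) * A l)) := by
        refine ENNReal.tsum_le_tsum fun l => ?_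
        calc ENNReal.ofReal (sobolevWeight s k) * (A (k - l) * A l)
            ≤ (2 : ℝ≥0∞) ^ s * (ENNReal.ofReal (sobolevWeight s (k - l)) +
                ENNReal.ofReal (sobolevWeight s l)) * (A (k - l) * A l) :=
              mul_le_mul_left (ofReal_sobolevWeight_peetre hs k l) _
          _ = (2 : ℝ≥0∞) ^ s * ((ENNReal.ofReal (sobolevWeight s (k - l)) * A (k - l)) * A l +
                A (k - l) * (ENNReal.ofReal (sobolevWeight s l) * A l)) := by
              ring
    _ = (2 : ℝ≥0∞) ^ s * (∑' l, (ENNReal.ofReal (sobolevWeight s (k - l)) * A (k - l)) * A l +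
          ∑' l, A (k - l) * (ENNReal.ofReal (sobolevWeight s l) * A l)) := by
        rw [ENNReal.tsum_mul_left, ENNReal.tsum_add]
    _ = (2 : ℝ≥0∞) ^ s * (∑' l, (ENNReal.ofReal (sobolevWeight s (k - l)) * A (k - l)) * A l +
          ∑' l, (ENNReal.ofReal (sobolevWeight s (k - l)) * A (k - l)) * A l) := by
        rw [lconv_comm A (fun l => ENNReal.ofReal (sobolevWeight s l) * A l) k]
    _ = (2 : ℝ≥0∞) ^ (s + 1) *
          ∑' l, (ENNReal.ofReal (sobolevWeight s (k - l)) * A (k - l)) * A l := by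
        rw [← two_mul, ← mul_assoc, ENNReal.rpow_add _ _ two_ne_zero ENNReal.ofNat_ne_top,
          ENNReal.rpow_one]

/-- **Hölder descent in the weights**: if `⟨·⟩^s A ∈ ℓ^r` and `∑ ⟨k⟩^{-t a r/(r-a)} < ∞`
(`0 < a < r`), then `⟨·⟩^{s-t} A ∈ ℓ^a`. [folklore] -/
theorem descent {s t a r : ℝ} (hB : ∑' k, (ENNReal.ofReal (sobolevWeight s k) * A k) ^ r ≠ ⊤)
    (ha : 0 < a) (har : a < r)
    (hw : ∑' k : d → ℤ, ENNReal.ofReal (sobolevWeight (-t * (a * r / (r - a))) k) ≠ ⊤) :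
    ∑' k, (ENNReal.ofReal (sobolevWeight (s - t) k) * A k) ^ a ≠ ⊤ := by
  have h := tsum_mul_rpow_ne_top (B := fun k => ENNReal.ofReal (sobolevWeight s k) * A k)
    (w := fun k => ENNReal.ofReal (sobolevWeight (-t) k)) ha har hB
    (by simpa only [ofReal_sobolevWeight_rpow] using hw)
  convert h using 3 with k
  rw [mul_right_comm, ofReal_sobolevWeight_mul, ← sub_eq_add_neg]

variable (hC : C ≠ ⊤) (hF : ∀ s : ℝ, ∑' k, ENNReal.ofReal (sobolevWeight s k) * F k ≠ ⊤)
  (hineq : ∀ k, ENNReal.ofReal (sobolevWeight 2 k) * A k ≤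
    C * (F k + ENNReal.ofReal (sobolevWeight 1 k) * ∑' l, A (k - l) * A l))

include hineq in
/-- The coefficient inequality with the weight moved inside the convolution:
`⟨k⟩² A(k) ≤ C F(k) + 4C ((⟨·⟩A) ⋆ A)(k)`. [folklore] -/
theorem weight_two_mul_le (k : d → ℤ) :
    ENNReal.ofReal (sobolevWeight 2 k) * A k ≤
      C * F k + (4 * C) * ∑' l, (ENNReal.ofReal (sobolevWeight 1 (k - l)) * A (k - l)) * A l := by
  refine (hineq k).trans ?_
  rw [mul_add]
  refine add_le_add le_rfl ?_
  have h := weight_mul_conv_le zero_le_one A k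
  rw [show (1 : ℝ) + 1 = 2 by norm_num, ENNReal.rpow_two] at h
  calc C * (ENNReal.ofReal (sobolevWeight 1 k) * ∑' l, A (k - l) * A l)
      ≤ C * ((2 : ℝ≥0∞) ^ 2 * ∑' l, (ENNReal.ofReal (sobolevWeight 1 (k - l)) * A (k - l)) * A l) :=
        mul_le_mul_right h _
    _ = (4 * C) * ∑' l, (ENNReal.ofReal (sobolevWeight 1 (k - l)) * A (k - l)) * A l := by
        rw [← mul_assoc]; congr 1; norm_num; ring

include hC hF hineq in
/-- **One Young step of the bootstrap**: `⟨·⟩A ∈ ℓ^a`, `A ∈ ℓ^b` with `1 ≤ a, b, r`,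
`1/a + 1/b = 1 + 1/r` give `⟨·⟩²A ∈ ℓ^r` (Young's inequality for `(⟨·⟩A) ⋆ A`, the coefficient
inequality, and `F ∈ ℓ^r`). [folklore] -/
theorem young_step {a b r : ℝ} (ha : 1 ≤ a) (hb : 1 ≤ b) (hr : 1 ≤ r)
    (habr : 1 / a + 1 / b = 1 + 1 / r)
    (h1 : ∑' k, (ENNReal.ofReal (sobolevWeight 1 k) * A k) ^ a ≠ ⊤) (h0 : ∑' k, A k ^ b ≠ ⊤) :
    ∑' k, (ENNReal.ofReal (sobolevWeight 2 k) * A k) ^ r ≠ ⊤ := by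
  have hr0 : 0 < r := by linarith
  -- Young
  have hY := young_lattice (fun k => ENNReal.ofReal (sobolevWeight 1 k) * A k) A ha hb hr0 habr
  have hconv :
      ∑' k, (∑' l, (ENNReal.ofReal (sobolevWeight 1 (k - l)) * A (k - l)) * A l) ^ r ≠ ⊤ := by
    refine ne_top_of_le_ne_top (ENNReal.mul_ne_top ?_ ?_) hY
    · exact ENNReal.rpow_ne_top_of_nonneg (div_nonneg hr0.le (by linarith)) h1
    · exact ENNReal.rpow_ne_top_of_nonneg (div_nonneg hr0.le (by linarith)) h0
  have hFr : ∑' k, F k ^ r ≠ ⊤ := by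
    have := tsum_weight_mul_rpow_ne_top_of_rapid hF hr 0
    simpa only [sobolevWeight_zero, ENNReal.ofReal_one, one_mul] using this
  -- pointwise
  have hpt : ∀ k, (ENNReal.ofReal (sobolevWeight 2 k) * A k) ^ r ≤
      (2 : ℝ≥0∞) ^ (r - 1) * (C ^ r * F k ^ r +
        (4 * C) ^ r *
          (∑' l, (ENNReal.ofReal (sobolevWeight 1 (k - l)) * A (k - l)) * A l) ^ r) := by
    intro k
    calc (ENNReal.ofReal (sobolevWeight 2 k) * A k) ^ r
        ≤ (C * F k +
            (4 * C) * ∑' l, (ENNReal.ofReal (sobolevWeight 1 (k - l)) * A (k - l)) * A l) ^ r :=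
          ENNReal.rpow_le_rpow (weight_two_mul_le hineq k) hr0.le
      _ ≤ (2 : ℝ≥0∞) ^ (r - 1) * ((C * F k) ^ r +
          ((4 * C) * ∑' l, (ENNReal.ofReal (sobolevWeight 1 (k - l)) * A (k - l)) * A l) ^ r) :=
          ENNReal.rpow_add_le_mul_rpow_add_rpow _ _ hr
      _ = _ := by
          rw [ENNReal.mul_rpow_of_nonneg _ _ hr0.le, ENNReal.mul_rpow_of_nonneg _ _ hr0.le]
  refine ne_top_of_le_ne_top ?_ (ENNReal.tsum_le_tsum hpt)
  rw [ENNReal.tsum_mul_left, ENNReal.tsum_add, ENNReal.tsum_mul_left, ENNReal.tsum_mul_left]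
  refine ENNReal.mul_ne_top (ENNReal.rpow_ne_top_of_nonneg (by linarith) ENNReal.ofNat_ne_top)
    (ENNReal.add_ne_top.2 ⟨ENNReal.mul_ne_top ?_ hFr, ENNReal.mul_ne_top ?_ hconv⟩)
  · exact ENNReal.rpow_ne_top_of_nonneg hr0.le hC
  · exact ENNReal.rpow_ne_top_of_nonneg hr0.le (ENNReal.mul_ne_top ENNReal.ofNat_ne_top hC)

include hC hF hineq in
/-- **The lattice bootstrap** (`#d ≤ 3`): a nonnegative family `A` on `ℤ^d` with
`∑ ⟨k⟩² A(k)² < ∞` satisfying `⟨k⟩² A(k) ≤ C (F(k) + ⟨k⟩ (A ⋆ A)(k))` with `F` rapidly decaying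
has `∑ ⟨k⟩^m A(k) < ∞` for every `m` — the `ℓ^p(ℤ^d)` form of the elliptic bootstrap of
Temam 1979, Ch. II Prop. 1.1 / Constantin–Foias 1988, Ch. 7 (7.10)–(7.11): three Young steps
with exponents `(2, 5/4; 10/3)`, `(5/3, 10/9; 2)`, `(5/4, 1; 5/4)` interleaved with Hölder
descents (lattice sums `∑⟨k⟩^{-10/3}, ∑⟨k⟩^{-4}, ∑⟨k⟩^{-5} < ∞` in `#d ≤ 3`), then the `ℓ¹`
induction with Young `(1, 1; 1)`. [cite: Temam1979, Ch. II Prop. 1.1] -/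
theorem tsum_weight_mul_ne_top (hd : Fintype.card d ≤ 3)
    (hA2 : ∑' k, ENNReal.ofReal (sobolevWeight 2 k) * A k ^ (2 : ℝ) ≠ ⊤) (m : ℕ) :
    ∑' k, ENNReal.ofReal (sobolevWeight m k) * A k ≠ ⊤ := by
  have hd' : (Fintype.card d : ℝ) ≤ 3 := by exact_mod_cast hd
  -- lattice sums
  have hL : ∀ e : ℝ, e < -3 → ∑' k : d → ℤ, ENNReal.ofReal (sobolevWeight e k) ≠ ⊤ := fun e he => by
    have h := tsum_ofReal_sobolevWeight_neg_ne_top (d := d) (q := -e) (by linarith)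
    simpa only [neg_neg] using h
  -- start: `⟨·⟩A ∈ ℓ²`
  have T1 : ∑' k, (ENNReal.ofReal (sobolevWeight 1 k) * A k) ^ (2 : ℝ) ≠ ⊤ := by
    have h : ∀ k, (ENNReal.ofReal (sobolevWeight 1 k) * A k) ^ (2 : ℝ) =
        ENNReal.ofReal (sobolevWeight 2 k) * A k ^ (2 : ℝ) := fun k => by
      rw [ENNReal.mul_rpow_of_nonneg _ _ zero_le_two, ofReal_sobolevWeight_rpow]
      norm_num
    rw [tsum_congr h]
    exact hA2
  -- S0: `A ∈ ℓ^{5/4}`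
  have T0 : ∑' k, A k ^ (5 / 4 : ℝ) ≠ ⊤ := by
    have h := descent (s := 1) (t := 1) (a := 5 / 4) (r := 2) T1 (by norm_num) (by norm_num)
      (hL _ (by norm_num))
    simpa only [sub_self, sobolevWeight_zero, ENNReal.ofReal_one, one_mul] using h
  -- S1: Young (2, 5/4; 10/3)
  have S1 : ∑' k, (ENNReal.ofReal (sobolevWeight 2 k) * A k) ^ (10 / 3 : ℝ) ≠ ⊤ :=
    young_step hC hF hineq (by norm_num) (by norm_num) (by norm_num) (by norm_num) T1 T0
  -- S1 descents
  have T1' : ∑' k, (ENNReal.ofReal (sobolevWeight 1 k) * A k) ^ (5 / 3 : ℝ) ≠ ⊤ := by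
    have h := descent (s := 2) (t := 1) (a := 5 / 3) (r := 10 / 3) S1 (by norm_num) (by norm_num)
      (hL _ (by norm_num))
    norm_num at h
    exact h
  have T0' : ∑' k, A k ^ (10 / 9 : ℝ) ≠ ⊤ := by
    have h := descent (s := 2) (t := 2) (a := 10 / 9) (r := 10 / 3) S1 (by norm_num) (by norm_num)
      (hL _ (by norm_num))
    simpa only [sub_self, sobolevWeight_zero, ENNReal.ofReal_one, one_mul] using h
  -- S2: Young (5/3, 10/9; 2)
  have S2 : ∑' k, (ENNReal.ofReal (sobolevWeight 2 k) * A k) ^ (2 : ℝ) ≠ ⊤ :=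
    young_step hC hF hineq (by norm_num) (by norm_num) (by norm_num) (by norm_num) T1' T0'
  -- S2 descents
  have U0 : ∑' k, A k ^ (1 : ℝ) ≠ ⊤ := by
    have h := descent (s := 2) (t := 2) (a := 1) (r := 2) S2 (by norm_num) (by norm_num)
      (hL _ (by norm_num))
    simpa only [sub_self, sobolevWeight_zero, ENNReal.ofReal_one, one_mul] using h
  have hA1 : ∑' k, A k ≠ ⊤ := by simpa only [ENNReal.rpow_one] using U0
  have U1 : ∑' k, (ENNReal.ofReal (sobolevWeight 1 k) * A k) ^ (5 / 4 : ℝ) ≠ ⊤ := by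
    have h := descent (s := 2) (t := 1) (a := 5 / 4) (r := 2) S2 (by norm_num) (by norm_num)
      (hL _ (by norm_num))
    norm_num at h
    exact h
  -- S3: Young (5/4, 1; 5/4)
  have S3 : ∑' k, (ENNReal.ofReal (sobolevWeight 2 k) * A k) ^ (5 / 4 : ℝ) ≠ ⊤ :=
    young_step hC hF hineq (by norm_num) (by norm_num) (by norm_num) (by norm_num) U1 U0
  have P1 : ∑' k, ENNReal.ofReal (sobolevWeight 1 k) * A k ≠ ⊤ := by
    have h := descent (s := 2) (t := 1) (a := 1) (r := 5 / 4) S3 (by norm_num) (by norm_num)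
      (hL _ (by norm_num))
    simp only [ENNReal.rpow_one] at h
    norm_num at h
    exact h
  -- the `ℓ¹` world
  have P0 : ∑' k, ENNReal.ofReal (sobolevWeight 0 k) * A k ≠ ⊤ := by
    simpa only [sobolevWeight_zero, ENNReal.ofReal_one, one_mul] using hA1
  have step : ∀ n : ℕ, ∑' k, ENNReal.ofReal (sobolevWeight ((n : ℝ) + 1) k) * A k ≠ ⊤ →
      ∑' k, ENNReal.ofReal (sobolevWeight ((n : ℝ) + 2) k) * A k ≠ ⊤ := by
    intro n hn1
    -- Young (1, 1; 1)
    have hY := young_lattice (fun k => ENNReal.ofReal (sobolevWeight ((n : ℝ) + 1) k) * A k) A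
      le_rfl le_rfl one_pos
      (by norm_num)
    simp only [ENNReal.rpow_one, div_one] at hY
    have hconv :
        ∑' k, ∑' l, (ENNReal.ofReal (sobolevWeight ((n : ℝ) + 1) (k - l)) * A (k - l)) * A l ≠ ⊤ :=
      ne_top_of_le_ne_top (ENNReal.mul_ne_top hn1 hA1) hY
    have hs : (0 : ℝ) ≤ (n : ℝ) + 1 := by positivity
    have hpt : ∀ k, ENNReal.ofReal (sobolevWeight ((n : ℝ) + 2) k) * A k ≤
        C * (ENNReal.ofReal (sobolevWeight n k) * F k) + C * (2 : ℝ≥0∞) ^ ((n : ℝ) + 1 + 1) *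
          ∑' l, (ENNReal.ofReal (sobolevWeight ((n : ℝ) + 1) (k - l)) * A (k - l)) * A l := by
      intro k
      have hsplit : ENNReal.ofReal (sobolevWeight ((n : ℝ) + 2) k) =
          ENNReal.ofReal (sobolevWeight n k) * ENNReal.ofReal (sobolevWeight 2 k) := by
        rw [ofReal_sobolevWeight_mul]
      calc ENNReal.ofReal (sobolevWeight ((n : ℝ) + 2) k) * A k
          = ENNReal.ofReal (sobolevWeight n k) * (ENNReal.ofReal (sobolevWeight 2 k) * A k) := by
            rw [hsplit, mul_assoc]
        _ ≤ ENNReal.ofReal (sobolevWeight n k) *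
              (C * (F k + ENNReal.ofReal (sobolevWeight 1 k) * ∑' l, A (k - l) * A l)) :=
            mul_le_mul_right (hineq k) _
        _ = C * (ENNReal.ofReal (sobolevWeight n k) * F k) +
              C * (ENNReal.ofReal (sobolevWeight ((n : ℝ) + 1) k) * ∑' l, A (k - l) * A l) := by
            rw [← ofReal_sobolevWeight_mul (n : ℝ) 1 k]; ring
        _ ≤ C * (ENNReal.ofReal (sobolevWeight n k) * F k) + C * ((2 : ℝ≥0∞) ^ ((n : ℝ) + 1 + 1) *
              ∑' l, (ENNReal.ofReal (sobolevWeight ((n : ℝ) + 1) (k - l)) * A (k - l)) * A l) :=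
            add_le_add le_rfl (mul_le_mul_right (weight_mul_conv_le hs A k) _)
        _ = _ := by ring
    refine ne_top_of_le_ne_top ?_ (ENNReal.tsum_le_tsum hpt)
    rw [ENNReal.tsum_add, ENNReal.tsum_mul_left, ENNReal.tsum_mul_left]
    refine ENNReal.add_ne_top.2 ⟨ENNReal.mul_ne_top hC (hF n), ENNReal.mul_ne_top
      (ENNReal.mul_ne_top hC ?_) hconv⟩
    exact ENNReal.rpow_ne_top_of_nonneg (by positivity) ENNReal.ofNat_ne_top
  -- induction
  have key : ∀ n : ℕ, ∑' k, ENNReal.ofReal (sobolevWeight n k) * A k ≠ ⊤ ∧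
      ∑' k, ENNReal.ofReal (sobolevWeight ((n : ℝ) + 1) k) * A k ≠ ⊤ := by
    intro n
    induction n with
    | zero =>
      refine ⟨?_, ?_⟩
      · simpa only [Nat.cast_zero] using P0
      · simpa only [Nat.cast_zero, zero_add] using P1
    | succ n ih =>
      refine ⟨?_, ?_⟩
      · simpa only [Nat.cast_succ] using ih.2
      · have := step n ih.2
        simpa only [Nat.cast_succ, add_assoc, one_add_one_eq_two] using this
  exact (key m).1

end Bootstrap


/-! ## The coefficient inequality of a steady weak solution -/

section Coefficients

variable [DecidableEq d]

omit [Fintype d] [DecidableEq d] in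
/-- `ℓ¹`-type bound of the Euclidean norm by the coordinates: `‖x‖ ≤ ∑ᵢ ‖xᵢ‖`. [folklore] -/
theorem norm_le_sum_norm_apply' {𝕜 : Type*} [RCLike 𝕜] {ι : Type*} [Fintype ι] [DecidableEq ι]
    (x : EuclideanSpace 𝕜 ι) : ‖x‖ ≤ ∑ i, ‖x i‖ := by
  have hx : x = ∑ i, x i • EuclideanSpace.single i (1 : 𝕜) := by
    conv_lhs => rw [← (EuclideanSpace.basisFun ι 𝕜).sum_repr x]
    simp [EuclideanSpace.basisFun_apply]
  conv_lhs => rw [hx]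
  refine (norm_sum_le _ _).trans (le_of_eq (Finset.sum_congr rfl fun i _ => ?_))
  rw [norm_smul, EuclideanSpace.single, PiLp.norm_single, norm_one, mul_one]

omit [DecidableEq d] in
/-- The quadratic fields `x ↦ vⱼ(x) v(x)` of an `L²` field are integrable. [folklore] -/
theorem integrable_apply_smul {v : UnitAddTorus d → EuclideanSpace ℝ d} (hv : MemLp v 2 volume)
    (j : d) : Integrable (fun x => v x j • v x) volume := by
  have hvm : AEStronglyMeasurable v volume := hv.aestronglyMeasurable
  have hjm : AEStronglyMeasurable (fun x => v x j) volume :=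
    (EuclideanSpace.proj j).continuous.comp_aestronglyMeasurable hvm
  refine Integrable.mono' (hv.integrable_norm_pow two_ne_zero) (hjm.smul hvm)
    (ae_of_all _ fun x => ?_)
  rw [norm_smul, sq]
  exact mul_le_mul_of_nonneg_right (by simpa using PiLp.norm_apply_le (v x) j) (norm_nonneg _)

/-- **The inertial pairing against a single real mode** `a = Re (e_k z)`:
`∫ ⟪Da(x) v(x), v(x)⟫ dx = ∑ⱼ Re ⟪𝓕(vⱼ v)(k), 2πi kⱼ z⟫_ℂ` (`Da(x) h = ∑ⱼ hⱼ ∂ⱼa(x)`,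
`∂ⱼ Re (e_k z) = Re (e_k 2πi kⱼ z)`, and `∫ ⟪w, Re (e_k z')⟫ = Re ⟪ŵ(k), z'⟫`). [folklore] -/
theorem inertialPairing_realTrigPoly_singleton
    (v : Lp (EuclideanSpace ℝ d) 2 (volume : Measure (UnitAddTorus d))) (k : d → ℤ)
    (z : EuclideanSpace ℂ d) :
    Torus.inertialPairing v (realTrigPoly {k} fun _ => z) =
      ∑ j, (inner ℂ (mFourierCoeff (EuclideanSpace.complexify ∘ fun x =>
        (v : UnitAddTorus d → EuclideanSpace ℝ d) x j •
          (v : UnitAddTorus d → EuclideanSpace ℝ d) x) k)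
        ((2 * Real.pi * Complex.I * (k j : ℂ)) • z)).re := by
  set V : UnitAddTorus d → EuclideanSpace ℝ d := (v : UnitAddTorus d → EuclideanSpace ℝ d) with hV
  have hV2 : MemLp V 2 volume := Lp.memLp v
  set a : UnitAddTorus d → EuclideanSpace ℝ d := realTrigPoly {k} fun _ => z with ha
  have ha1 : IsContDiff 1 a := (isSmooth_realTrigPoly _ _).isContDiff (by simp)
  -- the `j`-th partial derivative of the mode is again a mode
  set cj : d → (d → ℤ) → EuclideanSpace ℂ d := fun j m => (2 * Real.pi * Complex.I * (m j : ℂ)) • z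
    with hcj
  have hpd : ∀ (j : d) x, FunctionSpaces.Torus.partialDeriv j a x = realTrigPoly {k} (cj j) x :=
      fun j x => by
    rw [ha, partialDeriv_realTrigPoly]
  -- pointwise expansion of the integrand
  have hpt : ∀ x, ⟪FunctionSpaces.Torus.fderiv a x (V x), V x⟫_ℝ =
      ∑ j, ⟪V x j • V x, realTrigPoly {k} (cj j) x⟫_ℝ := by
    intro x
    rw [fderiv_apply_eq_sum_partialDeriv ha1 x (V x), sum_inner]
    refine Finset.sum_congr rfl fun j _ => ?_
    rw [real_inner_smul_left, real_inner_smul_left, hpd, real_inner_comm]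
  show ∫ x, ⟪FunctionSpaces.Torus.fderiv a x (V x), V x⟫_ℝ = _
  simp_rw [hpt]
  have hint : ∀ j, Integrable (fun x => ⟪V x j • V x, realTrigPoly {k} (cj j) x⟫_ℝ) volume :=
    fun j =>
    integrable_inner_of_continuous (integrable_apply_smul hV2 j) (continuous_realTrigPoly _ _)
  rw [integral_finsetSum _ fun j _ => hint j]
  refine Finset.sum_congr rfl fun j _ => ?_
  rw [integral_inner_realTrigPoly_singleton (integrable_apply_smul hV2 j) k (cj j)]

/-- **Bound for the inertial pairing against a single real mode** by the Fourier coefficients of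
the quadratic expressions `vⱼ vᵢ`:
`|∫ ⟪Da v, v⟫| ≤ ∑ⱼ ∑ᵢ 2π |kⱼ| ‖z‖ ‖𝓕(vⱼ vᵢ)(k)‖`, `a = Re (e_k z)`. [folklore] -/
theorem abs_inertialPairing_realTrigPoly_singleton_le
    (v : Lp (EuclideanSpace ℝ d) 2 (volume : Measure (UnitAddTorus d))) (k : d → ℤ)
    (z : EuclideanSpace ℂ d) :
    |Torus.inertialPairing v (realTrigPoly {k} fun _ => z)| ≤
      ∑ j, ∑ i, 2 * Real.pi * |(k j : ℝ)| * ‖z‖ *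
        ‖mFourierCoeff (fun x => (((v : UnitAddTorus d → EuclideanSpace ℝ d) x j *
          (v : UnitAddTorus d → EuclideanSpace ℝ d) x i : ℝ) : ℂ)) k‖ := by
  set V : UnitAddTorus d → EuclideanSpace ℝ d := (v : UnitAddTorus d → EuclideanSpace ℝ d) with hV
  have hV2 : MemLp V 2 volume := Lp.memLp v
  rw [inertialPairing_realTrigPoly_singleton]
  refine (Finset.abs_sum_le_sum_abs _ _).trans (Finset.sum_le_sum fun j _ => ?_)
  set W : EuclideanSpace ℂ d := mFourierCoeff (EuclideanSpace.complexify ∘ fun x => V x j • V x) k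
    with hW
  have hWi : ∀ i, W i = mFourierCoeff (fun x => ((V x j * V x i : ℝ) : ℂ)) k := fun i => by
    rw [hW, mFourierCoeff_complexify_apply (integrable_apply_smul hV2 j)]
    rfl
  have hsz : ‖(2 * Real.pi * Complex.I * (k j : ℂ)) • z‖ = 2 * Real.pi * |(k j : ℝ)| * ‖z‖ := by
    rw [norm_smul]
    congr 1
    rw [show (2 * Real.pi * Complex.I * (k j : ℂ) : ℂ) = ((2 * Real.pi * (k j : ℝ) : ℝ) : ℂ) *
        Complex.I by push_cast; ring]
    rw [norm_mul, Complex.norm_I, mul_one, Complex.norm_real, Real.norm_eq_abs, abs_mul,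
      abs_of_pos Real.two_pi_pos]
  calc |(inner ℂ W ((2 * Real.pi * Complex.I * (k j : ℂ)) • z)).re|
      ≤ ‖inner ℂ W ((2 * Real.pi * Complex.I * (k j : ℂ)) • z)‖ := Complex.abs_re_le_norm _
    _ ≤ ‖W‖ * ‖(2 * Real.pi * Complex.I * (k j : ℂ)) • z‖ := norm_inner_le_norm _ _
    _ ≤ (∑ i, ‖W i‖) * (2 * Real.pi * |(k j : ℝ)| * ‖z‖) := by
        rw [hsz]
        exact mul_le_mul_of_nonneg_right (norm_le_sum_norm_apply' W) (by positivity)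
    _ = ∑ i, 2 * Real.pi * |(k j : ℝ)| * ‖z‖ *
          ‖mFourierCoeff (fun x => ((V x j * V x i : ℝ) : ℂ)) k‖ := by
        rw [Finset.sum_mul]
        refine Finset.sum_congr rfl fun i _ => ?_
        rw [hWi, mul_comm]


omit [DecidableEq d] in
/-- **Fourier coefficients of a product of two components of an `L²` field are dominated by the
self-convolution of the coefficient norms**: `‖𝓕(uⱼ uᵢ)(k)‖ ≤ ∑_l ‖û(k - l)‖ ‖û(l)‖`,
`û = 𝓕(complexify ∘ u)` — the product formula `𝓕(uⱼ uᵢ)(k) = ∑_l ûⱼ(k - l) ûᵢ(l)` from the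
polarised Parseval identity `∑_l conj(ĝ(l)) ĥ(l) = ∫ conj(g) h` with `g = e_k uⱼ`, `h = uᵢ`
(Grafakos 2014, Prop. 3.2.7 (3)), `|ûᵢ(l)| ≤ ‖û(l)‖` and `‖û(-m)‖ = ‖û(m)‖` (reality).
[cite: Grafakos2014, Prop. 3.2.7 (3)] -/
theorem enorm_mFourierCoeff_mul_apply_le {u : UnitAddTorus d → EuclideanSpace ℝ d}
    (hu : MemLp u 2 volume) (i j : d) (k : d → ℤ) :
    ‖mFourierCoeff (fun x => ((u x j * u x i : ℝ) : ℂ)) k‖ₑ ≤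
      ∑' l, ‖mFourierCoeff (EuclideanSpace.complexify ∘ u) (k - l)‖ₑ *
        ‖mFourierCoeff (EuclideanSpace.complexify ∘ u) l‖ₑ := by
  have hui : Integrable u volume := hu.integrable one_le_two
  set c : (d → ℤ) → EuclideanSpace ℂ d := fun m => mFourierCoeff (EuclideanSpace.complexify ∘ u) m
    with hc
  -- the two scalar `L²` functions `g = e_k uⱼ`, `h = uᵢ`
  set g : UnitAddTorus d → ℂ := fun x => mFourier k x * (u x j : ℂ) with hg
  set h : UnitAddTorus d → ℂ := fun x => (u x i : ℂ) with hh
  have hhm : MemLp h 2 volume := memLp_ofReal_apply hu i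
  have hgj : MemLp (fun x => (u x j : ℂ)) 2 volume := memLp_ofReal_apply hu j
  have hgm : MemLp g 2 volume := by
    refine MemLp.of_le hgj ((mFourier k).continuous.aestronglyMeasurable.mul
      hgj.aestronglyMeasurable) (ae_of_all _ fun x => ?_)
    simp only [hg, norm_mul]
    calc ‖mFourier k x‖ * ‖(u x j : ℂ)‖ ≤ 1 * ‖(u x j : ℂ)‖ :=
          mul_le_mul_of_nonneg_right (((mFourier k).norm_coe_le_norm x).trans_eq mFourier_norm)
            (norm_nonneg _)
      _ = ‖(u x j : ℂ)‖ := one_mul _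
  -- polarised Parseval
  have H := hasSum_conj_mul_mFourierCoeff hgm hhm
  -- (i) the sum is `𝓕(uⱼ uᵢ)(k)`
  have hval : ∫ x, conj (g x) * h x = mFourierCoeff (fun x => ((u x j * u x i : ℝ) : ℂ)) k := by
    rw [mFourierCoeff_eq_integral_volume]
    refine integral_congr_ae (ae_of_all _ fun x => ?_)
    simp only [hg, hh, map_mul, Complex.conj_ofReal, ← mFourier_neg, smul_eq_mul,
      Complex.ofReal_mul]
    ring
  -- (ii) coefficients of `g`: `ĝ(l) = ûⱼ(l - k)`
  have hgc : ∀ l, mFourierCoeff g l = mFourierCoeff (fun x => (u x j : ℂ)) (l - k) := by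
    intro l
    rw [mFourierCoeff_eq_integral_volume, mFourierCoeff_eq_integral_volume]
    refine integral_congr_ae (ae_of_all _ fun x => ?_)
    simp only [hg, smul_eq_mul]
    rw [← mul_assoc, mFourier_neg_mul, show k - l = -(l - k) by abel]
  -- (iii) norms of scalar coefficients against the vector coefficient
  have hcoord : ∀ (i' : d) (m : d → ℤ), ‖mFourierCoeff (fun x => (u x i' : ℂ)) m‖ ≤ ‖c m‖ :=
    fun i' m => by
      rw [hc, ← mFourierCoeff_complexify_apply hui m i']
      exact PiLp.norm_apply_le _ i'
  have hsymm : ∀ m, ‖c (-m)‖ = ‖c m‖ := fun m => by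
    have := isConjSymm_mFourierCoeff hui m
    rw [hc]
    dsimp only at this ⊢
    rw [this, EuclideanSpace.norm_conjVec]
  -- assemble
  rw [← hval, ← H.tsum_eq]
  refine enorm_tsum_le_tsum_enorm.trans (ENNReal.tsum_le_tsum fun l => ?_)
  rw [enorm_mul, ← ofReal_norm, ← ofReal_norm, ← ofReal_norm (c (k - l)),
    ← ofReal_norm (c l), RCLike.norm_conj]
  refine mul_le_mul' (ENNReal.ofReal_le_ofReal ?_) (ENNReal.ofReal_le_ofReal (hcoord i l))
  rw [hgc]
  calc ‖mFourierCoeff (fun x => (u x j : ℂ)) (l - k)‖ ≤ ‖c (l - k)‖ := hcoord j _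
    _ = ‖c (k - l)‖ := by rw [← hsymm, neg_sub]


omit [DecidableEq d] in
/-- A single real mode at a nonzero frequency has zero mean (`∫ e_k = 0` for `k ≠ 0`,
`Torus.integral_mFourier`). [folklore] -/
theorem hasZeroMean_realTrigPoly_singleton {k : d → ℤ} (hk : k ≠ 0)
    (c : (d → ℤ) → EuclideanSpace ℂ d) : HasZeroMean (realTrigPoly {k} c) := by
  show ∫ x, EuclideanSpace.realPart (trigPoly {k} c x) = 0
  rw [EuclideanSpace.realPart.integral_comp_comm
    (continuous_trigPoly {k} c).integrable_unitAddTorus]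
  have h : ∫ x, trigPoly {k} c x = 0 := by
    simp_rw [trigPoly_apply, Finset.sum_singleton]
    rw [integral_smul_const, integral_mFourier, if_neg hk, zero_smul]
  rw [h, map_zero]

/-! ### The tested equation against single modes -/

/-- **The steady weak formulation tested against a single real mode**: for a steady weak solution
`u ∈ H`, `k ≠ 0` and `z ⊥ k` (so that `a = Re (e_k z) ∈ 𝒱`),
`4π²ν|k|² Re⟪û(k), z⟫ = Re⟪f̂(k), z⟫ + ∫ ⟪Da u, u⟫` (`(f, a) = Re⟪f̂(k), z⟫`,
`(u, Δa) = -4π²|k|² Re⟪û(k), z⟫`; Temam 1979, Ch. II (1.8)/(2.12) in Fourier variables).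
[cite: Temam1979, Ch. II Prop. 1.1] -/
theorem tested_singleMode {ν : ℝ} {f : UnitAddTorus d → EuclideanSpace ℝ d} (hf : IsSmooth f)
    {u : energySpace d} (hu : Torus.IsSteadyWeakSolution ν f u) {k : d → ℤ} (hk : k ≠ 0)
    {z : EuclideanSpace ℂ d} (hz : ∑ j, (k j : ℂ) * z j = 0) :
    ν * (4 * Real.pi ^ 2 * freqNormSq k) *
        (inner ℂ (mFourierCoeff (EuclideanSpace.complexify ∘
          ((u : Lp (EuclideanSpace ℝ d) 2 (volume : Measure (UnitAddTorus d))) :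
            UnitAddTorus d → EuclideanSpace ℝ d)) k) z).re =
      (inner ℂ (mFourierCoeff (EuclideanSpace.complexify ∘ f) k) z).re +
        Torus.inertialPairing (u : Lp (EuclideanSpace ℝ d) 2 (volume : Measure (UnitAddTorus d)))
          (realTrigPoly {k} fun _ => z) := by
  set V : UnitAddTorus d → EuclideanSpace ℝ d :=
    ((u : Lp (EuclideanSpace ℝ d) 2 (volume : Measure (UnitAddTorus d))) :
      UnitAddTorus d → EuclideanSpace ℝ d)
    with hV
  have hVi : Integrable V volume :=
    (Lp.memLp (u : Lp (EuclideanSpace ℝ d) 2 (volume : Measure (UnitAddTorus d)))).integrable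
      one_le_two
  set a : UnitAddTorus d → EuclideanSpace ℝ d := realTrigPoly {k} (fun _ => z) with ha
  have h0 := hu a (isSmooth_realTrigPoly _ _) (isDivFree_realTrigPoly_singleton hz)
    (hasZeroMean_realTrigPoly_singleton hk _)
  have h1 : ∫ x, ⟪f x, a x⟫_ℝ = (inner ℂ (mFourierCoeff (EuclideanSpace.complexify ∘ f) k) z).re :=
    integral_inner_realTrigPoly_singleton hf.integrable k _
  have h2 : ∫ x, ⟪V x, FunctionSpaces.Torus.laplacian a x⟫_ℝ =
      -(4 * Real.pi ^ 2 * freqNormSq k) *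
        (inner ℂ (mFourierCoeff (EuclideanSpace.complexify ∘ V) k) z).re := by
    have h : ∀ x, ⟪V x, FunctionSpaces.Torus.laplacian a x⟫_ℝ =
        -(4 * Real.pi ^ 2 * freqNormSq k) * ⟪V x, a x⟫_ℝ := fun x => by
      rw [ha, laplacian_realTrigPoly_singleton, real_inner_smul_right]
    simp_rw [h, integral_const_mul]
    rw [integral_inner_realTrigPoly_singleton hVi k _]
  have h3 : Torus.nsGeneratorPairing ν f u a =
      (∫ x, ⟪f x, a x⟫_ℝ) + ν * (∫ x, ⟪V x, FunctionSpaces.Torus.laplacian a x⟫_ℝ) +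
        Torus.inertialPairing (u : Lp (EuclideanSpace ℝ d) 2 (volume : Measure (UnitAddTorus d)))
          a := rfl
  rw [h3, h1, h2] at h0
  linear_combination -h0

/-- **The coefficient inequality of a steady weak solution** `u ∈ H` with smooth force and
`ν > 0`: with `û = 𝓕(complexify ∘ u)`,
`⟨k⟩² ‖û(k)‖ ≤ C_{ν,d} (‖f̂(k)‖ + ⟨k⟩ ∑_l ‖û(k - l)‖ ‖û(l)‖)` for every `k`,
`C_{ν,d} = (1 + 2π (#d)²)/(2π²ν)` (test against `Re (e_k z)` with the transversal unit vector
`z = û(k)/‖û(k)‖`, `û(0) = 0`, `⟨k⟩² ≤ 2|k|²` for `k ≠ 0`). [cite: Temam1979, Ch. II Prop. 1.1] -/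
theorem weight_two_mul_enorm_coeff_le {ν : ℝ} (hν : 0 < ν) {f : UnitAddTorus d → EuclideanSpace ℝ d}
    (hf : IsSmooth f) {u : energySpace d} (hu : Torus.IsSteadyWeakSolution ν f u) (k : d → ℤ) :
    ENNReal.ofReal (sobolevWeight 2 k) *
        ‖mFourierCoeff (EuclideanSpace.complexify ∘
          ((u : Lp (EuclideanSpace ℝ d) 2 (volume : Measure (UnitAddTorus d))) :
            UnitAddTorus d → EuclideanSpace ℝ d)) k‖ₑ ≤
      ENNReal.ofReal ((1 + 2 * Real.pi * (Fintype.card d : ℝ) ^ 2) / (2 * Real.pi ^ 2 * ν)) *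
        (‖mFourierCoeff (EuclideanSpace.complexify ∘ f) k‖ₑ +
          ENNReal.ofReal (sobolevWeight 1 k) *
            ∑' l, ‖mFourierCoeff (EuclideanSpace.complexify ∘
                ((u : Lp (EuclideanSpace ℝ d) 2 (volume : Measure (UnitAddTorus d))) :
                  UnitAddTorus d → EuclideanSpace ℝ d)) (k - l)‖ₑ *
              ‖mFourierCoeff (EuclideanSpace.complexify ∘
                ((u : Lp (EuclideanSpace ℝ d) 2 (volume : Measure (UnitAddTorus d))) :
                  UnitAddTorus d → EuclideanSpace ℝ d)) l‖ₑ) := by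
  set V : UnitAddTorus d → EuclideanSpace ℝ d :=
    ((u : Lp (EuclideanSpace ℝ d) 2 (volume : Measure (UnitAddTorus d))) :
      UnitAddTorus d → EuclideanSpace ℝ d)
    with hV
  have hV2 : MemLp V 2 volume :=
    Lp.memLp (u : Lp (EuclideanSpace ℝ d) 2 (volume : Measure (UnitAddTorus d)))
  have hVi : Integrable V volume := hV2.integrable one_le_two
  set c : (d → ℤ) → EuclideanSpace ℂ d := fun m => mFourierCoeff (EuclideanSpace.complexify ∘ V) m
    with hc
  set K : ℝ := (1 + 2 * Real.pi * (Fintype.card d : ℝ) ^ 2) / (2 * Real.pi ^ 2 * ν) with hK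
  show ENNReal.ofReal (sobolevWeight 2 k) * ‖c k‖ₑ ≤ ENNReal.ofReal K *
    (‖mFourierCoeff (EuclideanSpace.complexify ∘ f) k‖ₑ +
      ENNReal.ofReal (sobolevWeight 1 k) * ∑' l, ‖c (k - l)‖ₑ * ‖c l‖ₑ)
  -- trivial cases
  by_cases hk : k = 0
  · have h0 : c 0 = 0 := Torus.mFourierCoeff_complexify_coe_zero_of_mem u.2
    rw [hk, h0, enorm_zero, mul_zero]
    exact zero_le
  by_cases hck : c k = 0
  · rw [hck, enorm_zero, mul_zero]
    exact zero_le
  -- the transversal unit vector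
  have hT : ∑ j, (k j : ℂ) * c k j = 0 :=
    (Torus.isWeaklyDivFree_of_mem_energySpace u.2).sum_mul_mFourierCoeff_eq_zero hV2 k
  obtain ⟨z, hz, hz1, hzc⟩ := exists_transversal_unit_re_inner_eq hck hT
  -- the real inequality
  have hid := tested_singleMode hf hu hk hz
  rw [hzc] at hid
  set P : d → d → ℝ := fun j i => ‖mFourierCoeff (fun x => ((V x j * V x i : ℝ) : ℂ)) k‖ with hP
  have hreal : ν * (4 * Real.pi ^ 2 * freqNormSq k) * ‖c k‖ ≤
      ‖mFourierCoeff (EuclideanSpace.complexify ∘ f) k‖ +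
        ∑ j, ∑ i, 2 * Real.pi * |(k j : ℝ)| * P j i := by
    have hb1 : (inner ℂ (mFourierCoeff (EuclideanSpace.complexify ∘ f) k) z).re ≤
        ‖mFourierCoeff (EuclideanSpace.complexify ∘ f) k‖ :=
      (Complex.re_le_norm _).trans ((norm_inner_le_norm _ _).trans (by rw [hz1, mul_one]))
    have hb2 := (le_abs_self _).trans (abs_inertialPairing_realTrigPoly_singleton_le
      (u : Lp (EuclideanSpace ℝ d) 2 (volume : Measure (UnitAddTorus d))) k z)
    simp only [hz1, mul_one] at hb2
    linarith
  -- pass to `ℝ≥0∞`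
  have hfk : 0 ≤ freqNormSq k := freqNormSq_nonneg k
  have hE1 : ENNReal.ofReal (ν * (4 * Real.pi ^ 2 * freqNormSq k)) * ‖c k‖ₑ ≤
      ‖mFourierCoeff (EuclideanSpace.complexify ∘ f) k‖ₑ +
        ∑ j, ∑ i, ENNReal.ofReal (2 * Real.pi * |(k j : ℝ)|) * ‖mFourierCoeff
          (fun x => ((V x j * V x i : ℝ) : ℂ)) k‖ₑ := by
    have h := ENNReal.ofReal_le_ofReal hreal
    rw [ENNReal.ofReal_mul (by positivity), ofReal_norm, ENNReal.ofReal_add (norm_nonneg _)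
      (Finset.sum_nonneg fun j _ => Finset.sum_nonneg fun i _ => by positivity), ofReal_norm,
      ENNReal.ofReal_sum_of_nonneg (fun j _ => Finset.sum_nonneg fun i _ => by positivity)] at h
    refine h.trans (add_le_add le_rfl (Finset.sum_le_sum fun j _ => ?_))
    rw [ENNReal.ofReal_sum_of_nonneg (fun i _ => by positivity)]
    refine Finset.sum_le_sum fun i _ => ?_
    rw [ENNReal.ofReal_mul (by positivity), hP, ofReal_norm]
  -- the product bound and `|kⱼ| ≤ ⟨k⟩`
  have hkj : ∀ j, |(k j : ℝ)| ≤ sobolevWeight 1 k := fun j => by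
    refine (abs_apply_le_sqrt_freqNormSq k j).trans ?_
    rw [sobolevWeight, Real.sqrt_eq_rpow]
    exact Real.rpow_le_rpow hfk (by linarith) (by norm_num)
  have hE2 : ∑ j, ∑ i, ENNReal.ofReal (2 * Real.pi * |(k j : ℝ)|) * ‖mFourierCoeff
      (fun x => ((V x j * V x i : ℝ) : ℂ)) k‖ₑ ≤
      ENNReal.ofReal (2 * Real.pi * (Fintype.card d : ℝ) ^ 2 * sobolevWeight 1 k) *
        ∑' l, ‖c (k - l)‖ₑ * ‖c l‖ₑ := by
    calc ∑ j, ∑ i, ENNReal.ofReal (2 * Real.pi * |(k j : ℝ)|) * ‖mFourierCoeff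
          (fun x => ((V x j * V x i : ℝ) : ℂ)) k‖ₑ
        ≤ ∑ _j : d, ∑ _i : d, ENNReal.ofReal (2 * Real.pi * sobolevWeight 1 k) *
            ∑' l, ‖c (k - l)‖ₑ * ‖c l‖ₑ := by
          refine Finset.sum_le_sum fun j _ => Finset.sum_le_sum fun i _ => ?_
          exact mul_le_mul' (ENNReal.ofReal_le_ofReal (by nlinarith [hkj j, Real.pi_pos]))
            (enorm_mFourierCoeff_mul_apply_le hV2 i j k)
      _ = ENNReal.ofReal (2 * Real.pi * (Fintype.card d : ℝ) ^ 2 * sobolevWeight 1 k) *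
            ∑' l, ‖c (k - l)‖ₑ * ‖c l‖ₑ := by
          rw [Finset.sum_const, Finset.sum_const, Finset.card_univ, nsmul_eq_mul, nsmul_eq_mul,
            ← mul_assoc, ← mul_assoc]
          congr 1
          rw [← ENNReal.ofReal_natCast, ← ENNReal.ofReal_mul (Nat.cast_nonneg _),
            ← ENNReal.ofReal_mul (by positivity)]
          congr 1
          ring
  -- `⟨k⟩² ≤ 2 |k|²` for `k ≠ 0`
  have hw2 : sobolevWeight 2 k ≤
      (1 / (2 * Real.pi ^ 2 * ν)) * (ν * (4 * Real.pi ^ 2 * freqNormSq k)) := by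
    rw [show sobolevWeight 2 k = 1 + freqNormSq k by
      rw [sobolevWeight, div_self two_ne_zero, Real.rpow_one]]
    have h1 := Torus.one_le_freqNormSq hk
    have : (1 / (2 * Real.pi ^ 2 * ν)) * (ν * (4 * Real.pi ^ 2 * freqNormSq k)) =
        2 * freqNormSq k := by
      field_simp
      ring
    rw [this]
    linarith
  -- assemble
  calc ENNReal.ofReal (sobolevWeight 2 k) * ‖c k‖ₑ
      ≤ ENNReal.ofReal ((1 / (2 * Real.pi ^ 2 * ν)) * (ν * (4 * Real.pi ^ 2 * freqNormSq k))) *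
          ‖c k‖ₑ := mul_le_mul_left (ENNReal.ofReal_le_ofReal hw2) _
    _ = ENNReal.ofReal (1 / (2 * Real.pi ^ 2 * ν)) *
          (ENNReal.ofReal (ν * (4 * Real.pi ^ 2 * freqNormSq k)) * ‖c k‖ₑ) := by
          rw [ENNReal.ofReal_mul (by positivity), mul_assoc]
    _ ≤ ENNReal.ofReal (1 / (2 * Real.pi ^ 2 * ν)) *
          (‖mFourierCoeff (EuclideanSpace.complexify ∘ f) k‖ₑ +
            ENNReal.ofReal (2 * Real.pi * (Fintype.card d : ℝ) ^ 2 * sobolevWeight 1 k) *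
              ∑' l, ‖c (k - l)‖ₑ * ‖c l‖ₑ) := mul_le_mul_right (hE1.trans (add_le_add le_rfl hE2)) _
    _ ≤ ENNReal.ofReal (1 / (2 * Real.pi ^ 2 * ν)) *
          (ENNReal.ofReal (1 + 2 * Real.pi * (Fintype.card d : ℝ) ^ 2) *
            (‖mFourierCoeff (EuclideanSpace.complexify ∘ f) k‖ₑ +
              ENNReal.ofReal (sobolevWeight 1 k) * ∑' l, ‖c (k - l)‖ₑ * ‖c l‖ₑ)) := by
          refine mul_le_mul_right ?_ _
          rw [mul_add]
          refine add_le_add ?_ ?_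
          · exact le_mul_of_one_le_left (zero_le) (ENNReal.one_le_ofReal.2 (by
              nlinarith [Real.pi_pos, sq_nonneg (Fintype.card d : ℝ)]))
          · rw [← mul_assoc, ← ENNReal.ofReal_mul (by positivity)]
            refine mul_le_mul_left (ENNReal.ofReal_le_ofReal ?_) _
            have := sobolevWeight_pos (1 : ℝ) k
            nlinarith
    _ = ENNReal.ofReal K * (‖mFourierCoeff (EuclideanSpace.complexify ∘ f) k‖ₑ +
          ENNReal.ofReal (sobolevWeight 1 k) * ∑' l, ‖c (k - l)‖ₑ * ‖c l‖ₑ) := by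
          rw [← mul_assoc, ← ENNReal.ofReal_mul (by positivity), hK]
          congr 2
          field_simp


/-! ## Rapid decay of the coefficients and the smooth representative -/

/-- The Fourier coefficients of a smooth field satisfy `∑ ⟨k⟩^s ‖ĝ(k)‖ < ∞` for every real `s`
(rapid decay, `Torus.IsSmooth.rapidDecay_mFourierCoeff`, and `⟨k⟩^s ≤ (1 + |k|²)^m` for
`s ≤ 2m`). [folklore] -/
theorem tsum_weight_mul_enorm_ne_top_of_isSmooth {g : UnitAddTorus d → EuclideanSpace ℂ d}
    (hg : IsSmooth g) (s : ℝ) :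
    ∑' k, ENNReal.ofReal (sobolevWeight s k) * ‖mFourierCoeff g k‖ₑ ≠ ⊤ := by
  obtain ⟨m, hm⟩ : ∃ m : ℕ, s / 2 ≤ m := exists_nat_ge (s / 2)
  have hR : Summable fun k => (1 + freqNormSq k) ^ m * ‖mFourierCoeff g k‖ :=
    hg.rapidDecay_mFourierCoeff m
  have hle : ∀ k, ENNReal.ofReal (sobolevWeight s k) * ‖mFourierCoeff g k‖ₑ ≤
      ENNReal.ofReal ((1 + freqNormSq k) ^ m * ‖mFourierCoeff g k‖) := by
    intro k
    rw [← ofReal_norm, ← ENNReal.ofReal_mul (sobolevWeight_pos s k).le]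
    refine ENNReal.ofReal_le_ofReal (mul_le_mul_of_nonneg_right ?_ (norm_nonneg _))
    rw [sobolevWeight, ← Real.rpow_natCast]
    exact Real.rpow_le_rpow_of_exponent_le (by linarith [freqNormSq_nonneg k]) hm
  refine ne_top_of_le_ne_top ?_ (ENNReal.tsum_le_tsum hle)
  rw [← ENNReal.ofReal_tsum_of_nonneg (fun k => mul_nonneg
    (pow_nonneg (one_add_freqNormSq_pos k).le _) (norm_nonneg _)) hR]
  exact ENNReal.ofReal_ne_top

omit [DecidableEq d] in
/-- `H¹` membership in `ℝ≥0∞` form: `∑ ⟨k⟩² ‖ĝ(k)‖² < ∞`. [folklore] -/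
theorem tsum_weight_two_mul_enorm_sq_ne_top {g : UnitAddTorus d → EuclideanSpace ℂ d}
    (hg : MemSobolev 1 g) :
    ∑' k, ENNReal.ofReal (sobolevWeight 2 k) * ‖mFourierCoeff g k‖ₑ ^ (2 : ℝ) ≠ ⊤ := by
  have h := hg.2
  rw [eSobolevNorm] at h
  have h' : ∑' k, ENNReal.ofReal (sobolevWeight 1 k ^ 2) * ‖mFourierCoeff g k‖ₑ ^ 2 ≠ ⊤ := by
    intro htop
    rw [htop, ENNReal.top_rpow_of_pos (by norm_num)] at h
    exact lt_irrefl _ h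
  have heq : (fun k => ENNReal.ofReal (sobolevWeight 2 k) * ‖mFourierCoeff g k‖ₑ ^ (2 : ℝ)) =
      fun k => ENNReal.ofReal (sobolevWeight 1 k ^ 2) * ‖mFourierCoeff g k‖ₑ ^ 2 := by
    funext k
    rw [ENNReal.rpow_two, sobolevWeight_one_sq, sobolevWeight_two]
  rw [heq]
  exact h'

omit [DecidableEq d] in
/-- From `∑ ⟨k⟩^m ‖c k‖ < ∞` for all `m ∈ ℕ` to `Torus.RapidDecay c`. [folklore] -/
theorem rapidDecay_of_tsum_weight_mul_enorm_ne_top {c : (d → ℤ) → EuclideanSpace ℂ d}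
    (h : ∀ m : ℕ, ∑' k, ENNReal.ofReal (sobolevWeight m k) * ‖c k‖ₑ ≠ ⊤) : RapidDecay c := by
  intro m
  have hm := h (2 * m)
  have hnn : ∀ k, 0 ≤ (1 + freqNormSq k) ^ m * ‖c k‖ := fun k =>
    mul_nonneg (pow_nonneg (one_add_freqNormSq_pos k).le _) (norm_nonneg _)
  have hterm : ∀ k, ENNReal.ofReal (sobolevWeight ((2 * m : ℕ) : ℝ) k) * ‖c k‖ₑ =
      ((Real.toNNReal ((1 + freqNormSq k) ^ m * ‖c k‖) : ℝ≥0) : ℝ≥0∞) := by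
    intro k
    rw [← ofReal_norm, ← ENNReal.ofReal_mul (sobolevWeight_pos _ k).le, sobolevWeight,
      show ((2 * m : ℕ) : ℝ) / 2 = ((m : ℕ) : ℝ) by push_cast; ring, Real.rpow_natCast]
    rfl
  simp only [hterm] at hm
  have hs := NNReal.summable_coe.2 (ENNReal.tsum_coe_ne_top_iff_summable.1 hm)
  refine hs.congr fun k => ?_
  exact Real.coe_toNNReal _ (hnn k)

end Coefficients

end SteadyNS

/-! ## The discharge -/

section Discharge

open Literature.Analysis.FunctionSpaces Literature.Analysis.FunctionSpaces.Torus

/-- **Regularity of steady weak solutions** (Temam 1979, Ch. II, Prop. 1.1, space-periodic case):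
discharge of the named fact `Torus.Temam1979_steadyWeakSolution_smooth` — for `#d ≤ 3`,
`ν > 0`, `f ∈ C^∞(T^d; ℝ^d)` and a steady weak solution `u ∈ V`, `u` is a.e. equal to a `C^∞`
vector field. Proof: the coefficient inequality `SteadyNS.weight_two_mul_enorm_coeff_le`, the
lattice bootstrap `SteadyNS.tsum_weight_mul_ne_top` (rapid decay of `û`), and Fourier synthesis
(`Torus.RapidDecay.isSmooth_fourierSynth`, `Torus.ae_eq_of_forall_mFourierCoeff_eq`); the real
part of the synthesis is the smooth representative. [cite: Temam1979, Ch. II Prop. 1.1] -/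
theorem Torus.Temam1979_steadyWeakSolution_smooth_holds :
    Torus.Temam1979_steadyWeakSolution_smooth := by
  intro d _ _ hd ν hν f hf u hV hu
  set V : UnitAddTorus d → EuclideanSpace ℝ d :=
    ((u : Lp (EuclideanSpace ℝ d) 2 (volume : Measure (UnitAddTorus d))) :
      UnitAddTorus d → EuclideanSpace ℝ d)
    with hVdef
  have hV2 : MemLp V 2 volume :=
    Lp.memLp (u : Lp (EuclideanSpace ℝ d) 2 (volume : Measure (UnitAddTorus d)))
  have hVi : Integrable V volume := hV2.integrable one_le_two
  set c : (d → ℤ) → EuclideanSpace ℂ d := fun m => mFourierCoeff (EuclideanSpace.complexify ∘ V) m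
    with hcdef
  -- rapid decay of the Fourier coefficients of `u`
  have hrd : RapidDecay c := by
    refine SteadyNS.rapidDecay_of_tsum_weight_mul_enorm_ne_top fun m => ?_
    exact SteadyNS.tsum_weight_mul_ne_top (A := fun m => ‖c m‖ₑ)
      (F := fun m => ‖mFourierCoeff (EuclideanSpace.complexify ∘ f) m‖ₑ)
      (C := ENNReal.ofReal ((1 + 2 * Real.pi * (Fintype.card d : ℝ) ^ 2) / (2 * Real.pi ^ 2 * ν)))
      ENNReal.ofReal_ne_top (SteadyNS.tsum_weight_mul_enorm_ne_top_of_isSmooth hf.complexify_comp)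
      (SteadyNS.weight_two_mul_enorm_coeff_le hν hf hu) hd
      (SteadyNS.tsum_weight_two_mul_enorm_sq_ne_top hV.2) m
  -- the smooth representative: the real part of the Fourier synthesis
  refine ⟨fun x => EuclideanSpace.realPart (fourierSynth c x), ?_, ?_⟩
  · exact hrd.isSmooth_fourierSynth.comp_clm EuclideanSpace.realPart
  · have hae : (EuclideanSpace.complexify ∘ V) =ᵐ[volume] fourierSynth c :=
      ae_eq_of_forall_mFourierCoeff_eq (integrable_complexify_comp hVi)
        hrd.isSmooth_fourierSynth.integrable fun k => (hrd.mFourierCoeff_fourierSynth k).symm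
    filter_upwards [hae] with x hx
    rw [← hx, Function.comp_apply, EuclideanSpace.realPart_complexify]

end Discharge

end Literature.Analysis.FluidPDE
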